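import Literature.AnabelianGeometry.AbsoluteAnabelian.AbsTopIII.BiAnabelianTelecoreProofs

/-!
# [AbsTopIII] Definition 3.5 (iv) (b): the telecore boundary set `TeleJE` — instance forms, closure refuted

S. Mochizuki, *Topics in absolute anabelian geometry III*, Def 3.5 (iv) p. 76 (bib key
`MochizukiAbsTopIII2015`; kurims manuscript pages, lit key `paper:url-5493eb38cbb7`): a telecore
`𝔗` on `𝒟` over a core `(𝒮, 𝒳)` carries "a family of homotopies `𝒥`" whose boundary set consists of
the pairs of paths `([γ₃]∘[γ₁], [γ₃]∘[γ₂])` with `[γ₁], [γ₂]` co-verticial paths ENDING at the core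
vertex and `[γ₃]` a path STARTING from it (Def 3.5 (iv) (b)).  The cell's
`BiAnabelianSetting.TeleJE` (seat abc-iut-L4-t12, file `BiAnabelianTelecoreProofs.lean`) is exactly
this boundary PREDICATE for the telecore `𝔗_δ` of Cor 3.7 (ii) on `𝒟‡_δ`.

FACT-LIST row F-0334 lists `TeleJE` among the named Props of the frozen list; it is a
PARAMETRISED SCHEMA (a predicate on a pair of co-terminal paths `p q : Path a b` of `Γ⃗_{𝒟‡_δ}`),
not a closed statement.  This proof-only companion records the kernel facts that settle the row:

* `teleJE_iff` — the predicate unfolds to Def 3.5 (iv) (b) verbatim (so every consumer cites it by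
  `Iff.rfl`, as `teleT.boundary_iff` does);
* the INSTANCE FORMS the telecore `𝔗_δ` uses: `teleJE_comp_right` (core-suffix pairs lie in the
  boundary set — the printed generators), `teleJE_of_target_obs` (every pair of paths ending AT the
  core vertex), `teleJE_nil_obs`; together with t12's `isSaturated_teleJE` (saturation) and
  `teleT.restrict_E` (`𝒥|_𝒮 = ℋ`) these are all the instances consumed in the tree;
* `not_teleJE_nil_base`, `not_forall_teleJE` — the UNIVERSAL CLOSURE of the schema is FALSE for
  every bi-anabelian setting: the empty path at a first-row vertex `⋎` admits no decomposition
  through the core vertex (a path `v_𝒮 → ⋎ → … ` has positive length).  Refuting the closure of a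
  boundary predicate refutes nothing in print: Def 3.5 (iv) (b) DEFINES `𝒥`'s boundary set, it does
  not assert that every pair of paths belongs to it.

HONEST FRAMING: elementary path combinatorics in the oriented graph `Γ⃗_{𝒟‡_δ}`; refereed pre-IUT
anabelian bookkeeping; nothing here bears on [IUTchIII] Cor 3.12; a FACT-LIST row is an assumption
label, not an endorsement. [cite: MochizukiAbsTopIII2015, Definition 3.5 (iv) p.76]
-/

set_option autoImplicit false

namespace Literature.AnabelianGeometry.AbsoluteAnabelian.AbsTopIII

open CategoryTheory Quiver DiagramOfCategories

universe u

namespace BiAnabelianSetting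

variable {X E N : Type u} [Category.{u} X] [Category.{u} E] [Category.{u} N]
  (𝔖 : BiAnabelianSetting X E N)

/-! ## The predicate, unfolded -/

/-- `TeleJE p q` is Def 3.5 (iv) (b) verbatim: `p = [γ₃]∘[γ₁]`, `q = [γ₃]∘[γ₂]` for some paths
`[γ₁], [γ₂]` to the core vertex and `[γ₃]` from it (definitional unfolding, recorded for citation).
[cite: MochizukiAbsTopIII2015, Definition 3.5 (iv) p.76] -/
theorem teleJE_iff ⦃a b : 𝔖.teleShape.Vertex⦄ (p q : Path a b) :
    𝔖.TeleJE p q ↔ ∃ (p₁ q₁ : Path a 𝔖.teleShape.obs) (r : Path 𝔖.teleShape.obs b),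
      p = p₁.comp r ∧ q = q₁.comp r :=
  Iff.rfl

/-! ## Instance forms (the pairs the telecore `𝔗_δ` actually places in `𝒥`'s boundary set) -/

/-- The printed generators: for co-verticial `[γ₁], [γ₂]` ending at the core vertex and `[γ₃]`
starting from it, the pair `([γ₃]∘[γ₁], [γ₃]∘[γ₂])` lies in the boundary set of `𝒥`.
[cite: MochizukiAbsTopIII2015, Definition 3.5 (iv) p.76] -/
theorem teleJE_comp_right ⦃a b : 𝔖.teleShape.Vertex⦄ (p₁ q₁ : Path a 𝔖.teleShape.obs)
    (r : Path 𝔖.teleShape.obs b) : 𝔖.TeleJE (p₁.comp r) (q₁.comp r) :=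
  ⟨p₁, q₁, r, rfl, rfl⟩

/-- Every pair of co-verticial paths ENDING at the core vertex lies in the boundary set (`[γ₃]` the
empty path) — the instance behind `𝒥|_𝒮 = ℋ` (`teleT.restrict_E`): on the core `𝒟‡_{≤1}` the
included pairs in the boundary set are exactly those ending at `v_𝒮`.
[cite: MochizukiAbsTopIII2015, Definition 3.5 (iv) p.76] -/
theorem teleJE_of_target_obs ⦃a : 𝔖.teleShape.Vertex⦄ (p q : Path a 𝔖.teleShape.obs) :
    𝔖.TeleJE p q :=
  ⟨p, q, Path.nil, rfl, rfl⟩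

/-- In particular the empty path at the core vertex is `𝒥`-related to itself.
[cite: MochizukiAbsTopIII2015, Definition 3.5 (iv) p.76] -/
theorem teleJE_nil_obs :
    𝔖.TeleJE (Path.nil : Path 𝔖.teleShape.obs 𝔖.teleShape.obs) Path.nil :=
  𝔖.teleJE_of_target_obs Path.nil Path.nil

/-- A pair in the boundary set whose target is NOT the core vertex consists of paths of positive
length (each passes through `v_𝒮` and then leaves it along a telecore edge).
[cite: MochizukiAbsTopIII2015, Definition 3.5 (iv) p.76] -/
theorem length_pos_of_teleJE_base ⦃a : 𝔖.teleShape.Vertex⦄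
    {w : SubVertex {a : Cor37Vertex | a.InDaggerLe 1}} (p q : Path a (𝔖.teleShape.base w))
    (h : 𝔖.TeleJE p q) : 0 < p.length ∧ 0 < q.length := by
  obtain ⟨p₁, q₁, r, hp, hq⟩ := h
  cases r with
  | cons r' e' =>
    subst hp hq
    exact ⟨by rw [Path.comp_cons, Path.length_cons]; omega,
      by rw [Path.comp_cons, Path.length_cons]; omega⟩

/-! ## The universal closure of the schema is false (for every setting) -/

/-- The empty path at a vertex `⋎` of `𝒟†_{≤1}` is NOT `𝒥`-related to itself: it admits no
decomposition `[γ₃]∘[γ₁]` through the core vertex. [cite: MochizukiAbsTopIII2015, Definition 3.5 (iv) p.76] -/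
theorem not_teleJE_nil_base (w : SubVertex {a : Cor37Vertex | a.InDaggerLe 1}) :
    ¬ 𝔖.TeleJE (Path.nil : Path (𝔖.teleShape.base w) (𝔖.teleShape.base w)) Path.nil := by
  intro h
  have h0 := (𝔖.length_pos_of_teleJE_base Path.nil Path.nil h).1
  rw [Path.length_nil] at h0
  exact lt_irrefl 0 h0

/-- **The universal closure of the FACT-LIST schema row `TeleJE` (F-0334) is false** for every
bi-anabelian setting: not every pair of co-terminal paths of `Γ⃗_{𝒟‡_δ}` lies in the boundary set of
`𝒥` — witness the empty path at the first-row vertex `⋎ = 0`.  (Def 3.5 (iv) (b) DEFINES the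
boundary set; print asserts no such universal statement, so nothing printed is refuted.)
[cite: MochizukiAbsTopIII2015, Definition 3.5 (iv) p.76] -/
theorem not_forall_teleJE :
    ¬ ∀ ⦃a b : 𝔖.teleShape.Vertex⦄ (p q : Path a b), 𝔖.TeleJE p q := fun h =>
  𝔖.not_teleJE_nil_base ⟨Cor37Vertex.first 0, Cor37Vertex.first_inDaggerLe 0 le_rfl⟩
    (h Path.nil Path.nil)

/-- Equivalently, every setting has a pair of co-terminal paths outside the boundary set.
[cite: MochizukiAbsTopIII2015, Definition 3.5 (iv) p.76] -/
theorem exists_not_teleJE :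
    ∃ (a : 𝔖.teleShape.Vertex) (p : Path a a), ¬ 𝔖.TeleJE p p :=
  ⟨𝔖.teleShape.base ⟨Cor37Vertex.first 0, Cor37Vertex.first_inDaggerLe 0 le_rfl⟩, Path.nil,
    𝔖.not_teleJE_nil_base _⟩

/-- The boundary set of the telecore `𝔗_δ` of Cor 3.7 (ii) IS `TeleJE` (t12's `teleT`, field
`Jfam.E`), so the refutation and the instance forms above are statements about `𝔗_δ` itself: its
family `𝒥` is a PARTIAL family of homotopies (not every pair of paths is related), as a telecore's
`𝒥` must be whenever `𝒟` has a vertex other than the core.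
[cite: MochizukiAbsTopIII2015, Cor 3.7 (ii) p.87] -/
theorem teleT_E_iff (θ : FiberSquare.BiAnabelianLift 𝔖.gal) ⦃a b : 𝔖.teleShape.Vertex⦄
    (p q : Path a b) : (𝔖.teleT θ).Jfam.E p q ↔ 𝔖.TeleJE p q :=
  Iff.rfl

end BiAnabelianSetting

end Literature.AnabelianGeometry.AbsoluteAnabelian.AbsTopIII
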